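import Mathlib
import Summits.CriticalPhenomena.PercolationContinuityZ3.Theorems.PercNearOneGluingNoHeavyLowerTailKummerReflection
import Summits.CriticalPhenomena.PercolationContinuityZ3.Theorems.PercNearOneGluingNoHeavyLowerTailKummerPartner
import HarnessLib

/-!
# THEOREM RII: Region II of CONJECTURE A′ — `₂F₁(−ϑ,−m;γ;g)/₂F₁(−ϑ−1,−m;γ;g)` is completely monotone for ALL `0 < γ < 1 − ϑ`

Support file for the Sahi / Conjecture-P programme of route `PercNearOneGluingNoHeavy`
(`--supports stmt-CriticalPhenomena-4575`, prover prim-l12-p5 gen 41; proof note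
`prim-l12-p5/PROOF-REGION-II-KUMMER-REFLECTION-g41.md` §2).  No definitions, no named facts, no sorries.

g37 (`…LowerTailOddsBernstein`) proved CONJECTURE A′ — the W♯ odds of the pure grabber are discrete Bernstein, equivalently
`ρ_θ = Q_{θ−1}/Q_θ` is a completely monotone sequence (THEOREM E) — in REGION I (`γ ≥ 1 − θ₀`) and refuted it below the line
`θ + γ = 1` (THEOREM S); the strip `θ > 1`, `0 < γ < 1 − θ₀` (REGION II) remained open (numerically true, gens 37–40).
This file closes it:

* **`regionII_ratio_altSum_nonneg`** — BASE-II: for `0 ≤ g < 1`, `ϑ > 0`, `γ > 0`, `ϑ + γ < 1`, the sequence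
  `m ↦ H (−ϑ) γ m / H (−ϑ−1) γ m` is completely monotone.  PROOF = the Kummer-reflection bridge
  `regionII_ratio_altSum_nonneg_of_partner` (`…KummerReflection`: `ρ = (θ'/θ)·P₁/P + ((1−γ)h^{θ'}/θ)·h^m/(Q_θ P)`,
  `θ' = ϑ+γ`) fed with the analytic facts about the explicit reflected partner `P(m) = ₂F₁(1−γ−m,−θ';2−γ;g)`,
  `P₁(m) = ₂F₁(1−γ−m,1−θ';2−γ;g)` (`…KummerPartner`: contiguous relations, `θP(0) − θ'P₁(0) = (1−γ)(1−g)^{θ'}`,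
  Euler-integral positivity and complete monotonicity in the first parameter);
* `hyp_inv_ratio_altSum_regionII` — the vertical induction (g37 (★)) from the new base: `1/Q_θ` and `ρ_θ` CM for every
  `θ = θ₀ + 1 + n`, `θ₀ ∈ (0,1)`, `0 < γ < 1 − θ₀`;
* **`pureGrabber_oddsDiff_altSum_nonneg_of_one_lt`** — CONJECTURE A′ for EVERY `θ > 1` and EVERY `γ > 0` (Region I by g37,
  Region II by the above); with g37's THEOREM A′/THEOREM S for `θ ≤ 1` this SETTLES CONJECTURE A′: it holds iff `θ + γ ≥ 1`;
* `hypergeom_ratio_cm_regionII` — THEOREM RII with the Gauss sums written out;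
* `hyp_inv_altSum_nonneg_all` — THEOREM H′ for EVERY `θ > 0` at every level (g38 §8(C) closed);
* `lPlusC_div_factorial_tn_pureGrabber_of_one_lt` — THEOREM N⁺⁺⁺⁺: the W♯ kernel `[(l+λc̃_r)/(r−l)!]` is TN for every
  `θ > 1`, every `γ > 0` (Ewens level `s > −1`) and every `λ > 0` (TP_∞ of THEOREM N's two-ray class for all `q_A`).
-/

namespace Summit.CriticalPhenomena.PercolationContinuityZ3.Theorems

namespace HypergeomCM

open Finset MomentRatioTN
open scoped Nat

/-! ### THEOREM RII: Region II of CONJECTURE A′ (unconditional) -/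

section

variable (g : ℝ) (H : ℝ → ℝ → ℕ → ℝ)
  (hH : ∀ a c r, H a c r = ∑ k ∈ range (r + 1), (r.choose k : ℝ) * (-g) ^ k *
    ((∏ i ∈ range k, (a + i)) / (∏ i ∈ range k, (c + i))))
include hH

/-- **THEOREM RII (BASE-II on all of Region II).**  For `0 ≤ g < 1`, `ϑ > 0`, `γ > 0` with `ϑ + γ < 1`
(so `θ = ϑ+1 ∈ (1,2)` and `0 < γ < 2 − θ`: REGION II of CONJECTURE A′), the sequence
`m ↦ Q_ϑ(m)/Q_θ(m) = ₂F₁(−ϑ,−m;γ;g)/₂F₁(−ϑ−1,−m;γ;g)` is completely monotone.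
Proof: `regionII_ratio_altSum_nonneg_of_partner` with the explicit reflected partner
`P(m) = ₂F₁(1−γ−m, −θ'; 2−γ; g)`, `P₁(m) = ₂F₁(1−γ−m, 1−θ'; 2−γ; g)`, `θ' = ϑ+γ`, whose step relations, base value
`θP(0) − θ'P₁(0) = (1−γ)(1−g)^{θ'} > 0`, positivity and complete monotonicity are `hyperg_lower_fst/snd`, `hyperg_W0`,
`hyperg_pos`, `hyperg_delta` and `hyperg_altSum_fst_nonneg` (Euler's Beta integral) of `…LowerTailKummerPartner`. -/
theorem regionII_ratio_altSum_nonneg (hg0 : 0 ≤ g) (hg1 : g < 1) (ϑ γ : ℝ) (h0 : 0 < ϑ) (hγ : 0 < γ)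
    (hϑγ : ϑ + γ < 1) (k j : ℕ) :
    0 ≤ ∑ i ∈ range (k + 1), (-1 : ℝ) ^ i * (k.choose i : ℝ) * (H (-ϑ) γ (j + i) / H (-ϑ - 1) γ (j + i)) := by
  have hg : |g| < 1 := abs_lt.2 ⟨by linarith, hg1⟩
  have h1 : ϑ ≤ 1 := by linarith
  have hc : (0 : ℝ) < 2 - γ := by linarith
  have hb : (0 : ℝ) < 1 - (ϑ + γ) := by linarith
  set P : ℕ → ℝ := fun m => ordinaryHypergeometric (1 - γ - (m : ℝ)) (-(ϑ + γ)) (2 - γ) g with hPdef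
  set P₁ : ℕ → ℝ := fun m => ordinaryHypergeometric (1 - γ - (m : ℝ)) (1 - (ϑ + γ)) (2 - γ) g with hP₁def
  refine regionII_ratio_altSum_nonneg_of_partner g H hH hg0 hg1 ϑ γ h0 h1 hγ P P₁ ?_ ?_ ?_ ?_ ?_ ?_ k j
  · intro m
    have h := hyperg_lower_fst (-(ϑ + γ)) (1 - γ - (m : ℝ)) (2 - γ) g hc hg
    simp only [hPdef, hP₁def]
    push_cast
    rw [show (1 : ℝ) - γ - (m + 1) = 1 - γ - m - 1 by ring, show -(ϑ + γ) + 1 = 1 - (ϑ + γ) by ring] at *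
    linear_combination h
  · intro m
    have h := hyperg_lower_snd (-(ϑ + γ)) (1 - γ - (m : ℝ)) (2 - γ) g hc hg
    simp only [hPdef, hP₁def]
    push_cast
    rw [show (1 : ℝ) - γ - (m + 1) = 1 - γ - m - 1 by ring, show -(ϑ + γ) + 1 = 1 - (ϑ + γ) by ring] at *
    linear_combination h
  · have h := hyperg_W0 (ϑ + γ) γ g (by linarith) hg
    simp only [hPdef, hP₁def, Nat.cast_zero, sub_zero]
    have hpos : 0 ≤ (1 - γ) * (1 - g) ^ (ϑ + γ) := mul_nonneg (by linarith) (Real.rpow_nonneg (by linarith) _)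
    rw [show ϑ + 1 = ϑ + γ + 1 - γ by ring]
    linarith [h, hpos]
  · have hP0 : 0 < P 0 := by
      simp only [hPdef, Nat.cast_zero, sub_zero]
      rw [hyperg_symm]
      exact hyperg_pos _ _ _ _ (by linarith) (by linarith) hg0 hg1
    have hmono : ∀ m : ℕ, P m ≤ P (m + 1) := by
      intro m
      have hΔ := hyperg_delta (-(ϑ + γ)) (1 - γ - (m : ℝ)) (2 - γ) g hc hg
      have hF : 0 ≤ ordinaryHypergeometric (1 - γ - (m : ℝ)) (-(ϑ + γ) + 1) (2 - γ + 1) g := by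
        have := hyperg_altSum_fst_nonneg (1 - γ) (-(ϑ + γ) + 1) (2 - γ + 1) g (by linarith) (by linarith) hg0 hg1 0 m
        simpa using this
      simp only [hPdef]
      push_cast
      rw [show (1 : ℝ) - γ - (m + 1) = 1 - γ - m - 1 by ring]
      have : 0 ≤ -(-(ϑ + γ) * g / (2 - γ)) * ordinaryHypergeometric (1 - γ - (m : ℝ)) (-(ϑ + γ) + 1) (2 - γ + 1) g := by
        have hcoef : 0 ≤ -(-(ϑ + γ) * g / (2 - γ)) := by
          rw [neg_mul, neg_div, neg_neg]; positivity
        exact mul_nonneg hcoef hF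
      linarith
    intro m
    induction m with
    | zero => exact hP0
    | succ n ih => exact lt_of_lt_of_le ih (hmono n)
  · intro k j
    have hΔ : ∀ m : ℕ, P (m + 1) - P m =
        (ϑ + γ) * g / (2 - γ) * ordinaryHypergeometric (1 - γ - (m : ℝ)) (1 - (ϑ + γ)) (3 - γ) g := by
      intro m
      have h := hyperg_delta (-(ϑ + γ)) (1 - γ - (m : ℝ)) (2 - γ) g hc hg
      simp only [hPdef]
      push_cast
      rw [show (1 : ℝ) - γ - (m + 1) = 1 - γ - m - 1 by ring, h,
        show -(ϑ + γ) + 1 = 1 - (ϑ + γ) by ring, show (2 : ℝ) - γ + 1 = 3 - γ by ring]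
      ring
    have e : ∀ i : ℕ, P (j + i + 1) - P (j + i) = (ϑ + γ) * g / (2 - γ) *
        ordinaryHypergeometric (1 - γ - ((j + i : ℕ) : ℝ)) (1 - (ϑ + γ)) (3 - γ) g := fun i => hΔ (j + i)
    simp_rw [e]
    have hc' := altSum_const_mul ((ϑ + γ) * g / (2 - γ))
      (fun m : ℕ => ordinaryHypergeometric (1 - γ - (m : ℝ)) (1 - (ϑ + γ)) (3 - γ) g) k j
    beta_reduce at hc'
    rw [hc']
    exact mul_nonneg (by positivity)
      (hyperg_altSum_fst_nonneg (1 - γ) (1 - (ϑ + γ)) (3 - γ) g hb (by linarith) hg0 hg1 k j)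
  · intro k j
    have e : ∀ i : ℕ, P₁ (j + i) = ordinaryHypergeometric (1 - γ - ((j + i : ℕ) : ℝ)) (1 - (ϑ + γ)) (2 - γ) g :=
      fun i => rfl
    simp_rw [e]
    exact hyperg_altSum_fst_nonneg (1 - γ) (1 - (ϑ + γ)) (2 - γ) g hb (by linarith) hg0 hg1 k j

/-- **Vertical induction above Region II** (g37 (★) run from the new base): for `θ₀ ∈ (0,1)`, level `0 < c < 1 − θ₀`,
every `θ = θ₀ + 1 + n` has `1/Q_θ` and `ρ_θ = Q_{θ−1}/Q_θ` completely monotone.  Base `n = 0`: THEOREM H′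
(`hyp_inv_altSum_nonneg_le_two_anylevel`) and THEOREM RII; step: the Gauss/Riccati recursion of `hyp_inv_altSum_aux'`. -/
theorem hyp_inv_ratio_altSum_regionII (hg0 : 0 ≤ g) (hg1 : g < 1) (c : ℝ) (hc0 : 0 < c) (θ₀ : ℝ) (h0 : 0 < θ₀)
    (hc1 : θ₀ + c < 1) : ∀ n : ℕ,
      (∀ k j, 0 ≤ ∑ i ∈ range (k + 1), (-1 : ℝ) ^ i * (k.choose i : ℝ) * (H (-(θ₀ + 1 + n)) c (j + i))⁻¹) ∧
      (∀ k j, 0 ≤ ∑ i ∈ range (k + 1), (-1 : ℝ) ^ i * (k.choose i : ℝ) *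
        (H (1 - (θ₀ + 1 + n)) c (j + i) * (H (-(θ₀ + 1 + n)) c (j + i))⁻¹)) := by
  have hPpos : ∀ ϑ : ℝ, 0 ≤ ϑ → ∀ r, 0 < H (-ϑ) c r :=
    fun ϑ hϑ r => hyp_pos g H hH hg0 hg1 (-ϑ) r c hc0 (by linarith)
  intro n
  induction n with
  | zero =>
    have e1 : -(θ₀ + 1 + ((0 : ℕ) : ℝ)) = -θ₀ - 1 := by push_cast; ring
    have e2 : (1 : ℝ) - (θ₀ + 1 + ((0 : ℕ) : ℝ)) = -θ₀ := by push_cast; ring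
    simp only [e1, e2]
    refine ⟨fun k j => hyp_inv_altSum_nonneg_le_two_anylevel g H hH hg0 hg1 c hc0 θ₀ h0 (by linarith) k j,
      fun k j => ?_⟩
    have h := regionII_ratio_altSum_nonneg g H hH hg0 hg1 θ₀ c h0 hc0 hc1 k j
    simpa only [div_eq_mul_inv] using h
  | succ n ih =>
    obtain ⟨ihA, ihB⟩ := ih
    have e1 : -(θ₀ + 1 + ((n + 1 : ℕ) : ℝ)) = -(θ₀ + 1 + n) - 1 := by push_cast; ring
    have e2 : (1 : ℝ) - (θ₀ + 1 + ((n + 1 : ℕ) : ℝ)) = -(θ₀ + 1 + n) := by push_cast; ring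
    simp only [e1, e2]
    set ϑ : ℝ := θ₀ + 1 + (n : ℝ) with hϑdef
    have hϑ0 : 0 < ϑ := by rw [hϑdef]; positivity
    have hcϑ : 0 < c + ϑ := by linarith
    have hP0 : ∀ r, 0 < H (-ϑ) c r := hPpos ϑ hϑ0.le
    have hP1 : ∀ r, 0 < H (-ϑ - 1) c r := fun r => by
      have := hPpos (ϑ + 1) (by linarith) r
      rwa [show -(ϑ + 1) = -ϑ - 1 by ring] at this
    have hR : ∀ r : ℕ, H (-ϑ - 1) c r * (H (-ϑ) c r)⁻¹ =
        ((2 * ϑ + c + ((r : ℝ) - ϑ) * g) - ϑ * (1 - g) * (H (1 - ϑ) c r * (H (-ϑ) c r)⁻¹)) / (c + ϑ) := by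
      intro r
      have hg' := hyp_gauss g H hH r (-ϑ) c hc0
      rw [show -ϑ + 1 = 1 - ϑ by ring] at hg'
      have h0' := (hP0 r).ne'
      have hcϑ' := hcϑ.ne'
      field_simp
      linear_combination hg'
    have hΔR : ∀ r : ℕ, H (-ϑ - 1) c (r + 1) * (H (-ϑ) c (r + 1))⁻¹ - H (-ϑ - 1) c r * (H (-ϑ) c r)⁻¹ =
        g / (c + ϑ) + ϑ * (1 - g) / (c + ϑ) *
          (H (1 - ϑ) c r * (H (-ϑ) c r)⁻¹ - H (1 - ϑ) c (r + 1) * (H (-ϑ) c (r + 1))⁻¹) := by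
      intro r
      rw [hR (r + 1), hR r]
      have hcϑ' := hcϑ.ne'
      push_cast
      field_simp
      ring
    have hΔR_cm : ∀ k j, 0 ≤ ∑ i ∈ range (k + 1), (-1 : ℝ) ^ i * (k.choose i : ℝ) *
        (H (-ϑ - 1) c (j + i + 1) * (H (-ϑ) c (j + i + 1))⁻¹ - H (-ϑ - 1) c (j + i) * (H (-ϑ) c (j + i))⁻¹) := by
      intro k j
      simp_rw [hΔR]
      rw [altSum_const_add_mul (g / (c + ϑ)) (ϑ * (1 - g) / (c + ϑ))
        (fun r => H (1 - ϑ) c r * (H (-ϑ) c r)⁻¹ - H (1 - ϑ) c (r + 1) * (H (-ϑ) c (r + 1))⁻¹) k j]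
      have hk : ∑ i ∈ range (k + 1), (-1 : ℝ) ^ i * (k.choose i : ℝ) *
          (H (1 - ϑ) c (j + i) * (H (-ϑ) c (j + i))⁻¹ - H (1 - ϑ) c (j + i + 1) * (H (-ϑ) c (j + i + 1))⁻¹) =
          ∑ i ∈ range (k + 2), (-1 : ℝ) ^ i * ((k + 1).choose i : ℝ) *
            (H (1 - ϑ) c (j + i) * (H (-ϑ) c (j + i))⁻¹) :=
        (altSum_succ (fun r => H (1 - ϑ) c r * (H (-ϑ) c r)⁻¹) k j).symm
      rw [hk]
      have hB := ihB (k + 1) j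
      have : (0 : ℝ) ≤ (1 - 1) ^ k := pow_nonneg (by norm_num) k
      have hA : 0 ≤ g / (c + ϑ) := div_nonneg hg0 hcϑ.le
      have hB0 : 0 ≤ ϑ * (1 - g) / (c + ϑ) := div_nonneg (mul_nonneg hϑ0.le (by linarith)) hcϑ.le
      positivity
    have hRinv : ∀ k j, 0 ≤ ∑ i ∈ range (k + 1), (-1 : ℝ) ^ i * (k.choose i : ℝ) *
        (H (-ϑ) c (j + i) * (H (-ϑ - 1) c (j + i))⁻¹) := by
      intro k j
      have := altSum_inv_nonneg (fun r => H (-ϑ - 1) c r * (H (-ϑ) c r)⁻¹)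
        (fun r => mul_pos (hP1 r) (inv_pos.2 (hP0 r))) hΔR_cm k j
      simpa only [mul_inv_rev, inv_inv] using this
    refine ⟨fun k j => ?_, hRinv⟩
    have e : ∀ r, (H (-ϑ - 1) c r)⁻¹ = (H (-ϑ) c r)⁻¹ * (H (-ϑ) c r * (H (-ϑ - 1) c r)⁻¹) := by
      intro r
      have h0 := (hP0 r).ne'
      field_simp
    have hsum : (∑ i ∈ range (k + 1), (-1 : ℝ) ^ i * (k.choose i : ℝ) * (H (-ϑ - 1) c (j + i))⁻¹) =
        ∑ i ∈ range (k + 1), (-1 : ℝ) ^ i * (k.choose i : ℝ) *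
          ((H (-ϑ) c (j + i))⁻¹ * (H (-ϑ) c (j + i) * (H (-ϑ - 1) c (j + i))⁻¹)) :=
      sum_congr rfl fun i _ => by rw [← e (j + i)]
    rw [hsum]
    exact altSum_mul_nonneg (fun r => (H (-ϑ) c r)⁻¹) (fun r => H (-ϑ) c r * (H (-ϑ - 1) c r)⁻¹)
      ihA hRinv k j

/-- **CONJECTURE A′ for every `θ > 1`** (all `γ > 0`, `0 ≤ g < 1`): writing `θ = θ₀ + (n+1)` with `θ₀ ∈ (0,1]`, the W♯ odds
`a_m = m·P_θ(m−1)/(γ·Q_θ(m))` of the pure grabber have completely monotone first difference — Region I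
(`γ ≥ 1 − θ₀`: g37's `pureGrabber_oddsDiff_altSum_nonneg`) or Region II (`γ < 1 − θ₀`: THEOREM RII + vertical induction +
THEOREM E(i) `oddsDiff_altSum_nonneg_of_ratio`).  Together with g37's THEOREM A′ (`θ ≤ 1`, `θ+γ ≥ 1`) and THEOREM S
(`θ < 1`, `θ+γ < 1`: false) this settles CONJECTURE A′: it holds iff `θ + γ ≥ 1`. -/
theorem pureGrabber_oddsDiff_altSum_nonneg_of_one_lt (hg0 : 0 ≤ g) (hg1 : g < 1) (θ₀ : ℝ) (h0 : 0 < θ₀)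
    (h1 : θ₀ ≤ 1) (n : ℕ) (γ : ℝ) (hγ : 0 < γ) (k j : ℕ) :
    0 ≤ ∑ i ∈ range (k + 1), (-1 : ℝ) ^ i * (k.choose i : ℝ) *
      ((((j + i + 1 : ℕ) : ℝ)) * H (-(θ₀ + ((n + 1 : ℕ) : ℝ))) (γ + 1) (j + i + 1 - 1) /
          (γ * H (-(θ₀ + ((n + 1 : ℕ) : ℝ))) γ (j + i + 1)) -
        (((j + i : ℕ) : ℝ)) * H (-(θ₀ + ((n + 1 : ℕ) : ℝ))) (γ + 1) (j + i - 1) /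
          (γ * H (-(θ₀ + ((n + 1 : ℕ) : ℝ))) γ (j + i))) := by
  rcases le_or_gt (1 - θ₀) γ with hI | hII
  · exact pureGrabber_oddsDiff_altSum_nonneg g H hH hg0 hg1 θ₀ h0 h1 (n + 1) γ hγ hI k j
  · have hρ := (hyp_inv_ratio_altSum_regionII g H hH hg0 hg1 γ hγ θ₀ h0 (by linarith) n).2
    have hθ : (0 : ℝ) ≤ θ₀ + ((n + 1 : ℕ) : ℝ) := by positivity
    have hQ : ∀ m, 0 < H (-(θ₀ + ((n + 1 : ℕ) : ℝ))) γ m := fun m =>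
      hyp_pos g H hH hg0 hg1 (-(θ₀ + ((n + 1 : ℕ) : ℝ))) m γ hγ (by linarith)
    refine oddsDiff_altSum_nonneg_of_ratio g H hH hg0 hg1 (θ₀ + ((n + 1 : ℕ) : ℝ)) γ hθ hγ hQ (fun k j => ?_) k j
    have e : θ₀ + ((n + 1 : ℕ) : ℝ) = θ₀ + 1 + n := by push_cast; ring
    rw [e]
    simpa only [div_eq_mul_inv] using hρ k j

/-- **THEOREM H′ for every `θ > 0`** (`1/₂F₁(−θ,−m;c;g)` completely monotone at EVERY level `c > 0`), in the parametrised
form `θ = θ₀ + n`, `θ₀ ∈ (0,1]`: `n = 0` is `hyp_inv_altSum_nonneg_le_one_anylevel`, `c ≥ 1 − θ₀` is g37's Region-I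
induction `hyp_inv_altSum_aux'`, and `c < 1 − θ₀`, `n ≥ 1` is `hyp_inv_ratio_altSum_regionII`.  (g38 §8(C): previously open
for `θ > 2` at levels `c < 1 − θ₀`.) -/
theorem hyp_inv_altSum_nonneg_all (hg0 : 0 ≤ g) (hg1 : g < 1) (c : ℝ) (hc0 : 0 < c) (θ₀ : ℝ) (h0 : 0 < θ₀)
    (h1 : θ₀ ≤ 1) (n : ℕ) (k j : ℕ) :
    0 ≤ ∑ i ∈ range (k + 1), (-1 : ℝ) ^ i * (k.choose i : ℝ) * (H (-(θ₀ + n)) c (j + i))⁻¹ := by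
  rcases le_or_gt (1 - θ₀) c with hI | hII
  · exact (hyp_inv_altSum_aux' g H hH hg0 hg1 c hc0 θ₀ h0 h1 hI n).1 k j
  · cases n with
    | zero =>
      have := hyp_inv_altSum_nonneg_le_one_anylevel g H hH hg0 hg1 c hc0 θ₀ h0 h1 k j
      simpa using this
    | succ n =>
      have h := (hyp_inv_ratio_altSum_regionII g H hH hg0 hg1 c hc0 θ₀ h0 (by linarith) n).1 k j
      have e : θ₀ + ((n + 1 : ℕ) : ℝ) = θ₀ + 1 + n := by push_cast; ring
      rw [e]
      exact h


end

/-- **THEOREM RII, closed form.**  For `θ ∈ (1,2)`, `0 < γ < 2 − θ`, `0 ≤ g < 1` and all `k, j`: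
`Σ_{i≤k} (−1)^i C(k,i) · ₂F₁(1−θ,−(j+i);γ;g)/₂F₁(−θ,−(j+i);γ;g) ≥ 0`, the Gauss sums written out as finite sums. -/
theorem hypergeom_ratio_cm_regionII (θ γ g : ℝ) (hθ1 : 1 < θ) (hθγ : θ + γ < 2) (hγ : 0 < γ) (hg0 : 0 ≤ g)
    (hg1 : g < 1) (k j : ℕ) :
    0 ≤ ∑ i ∈ range (k + 1), (-1 : ℝ) ^ i * (k.choose i : ℝ) *
      ((∑ l ∈ range (j + i + 1), ((j + i).choose l : ℝ) * (-g) ^ l *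
          ((∏ m ∈ range l, (1 - θ + m)) / (∏ m ∈ range l, (γ + m)))) /
        (∑ l ∈ range (j + i + 1), ((j + i).choose l : ℝ) * (-g) ^ l *
          ((∏ m ∈ range l, (-θ + m)) / (∏ m ∈ range l, (γ + m))))) := by
  set H : ℝ → ℝ → ℕ → ℝ := fun a c r => ∑ l ∈ range (r + 1), (r.choose l : ℝ) * (-g) ^ l *
    ((∏ m ∈ range l, (a + m)) / (∏ m ∈ range l, (c + m))) with hHdef
  have hH : ∀ a c r, H a c r = ∑ l ∈ range (r + 1), (r.choose l : ℝ) * (-g) ^ l *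
      ((∏ m ∈ range l, (a + m)) / (∏ m ∈ range l, (c + m))) := fun a c r => rfl
  have main := regionII_ratio_altSum_nonneg g H hH hg0 hg1 (θ - 1) γ (by linarith) hγ (by linarith) k j
  have e1 : -(θ - 1) = 1 - θ := by ring
  have e2 : -(θ - 1) - 1 = -θ := by ring
  rw [e2, e1] at main
  simpa only [hHdef] using main

/-- **THEOREM N⁺⁺⁺⁺ (TP_∞ for every `q_A`, every `θ > 1`, every Ewens level `s > −1`).**  Same statement as g37's
`lPlusC_div_factorial_tn_pureGrabber` with `θ = θ₀ + (n+1)` and NO restriction `1 − θ₀ ≤ γ`: for every `λ > 0` the kernel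
`[(l + λ·c̃_r)/(r−l)!]_{l ≤ r}`, `c̃_r = γ Q_θ(r)/P_θ(r−1)` the pure grabber, is totally nonnegative. -/
theorem lPlusC_div_factorial_tn_pureGrabber_of_one_lt (θ₀ : ℝ) (n : ℕ) (γ g : ℝ) (h0 : 0 < θ₀) (h1 : θ₀ ≤ 1)
    (hγ : 0 < γ) (hg0 : 0 ≤ g) (hg1 : g < 1) (lam : ℝ) (hlam : 0 < lam)
    {k : ℕ} (r c' : Fin k → ℕ) (hr : StrictMono r) (hc' : StrictMono c') :
    0 ≤ (Matrix.of fun i j =>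
      if c' j ≤ r i then ((c' j : ℝ) + lam *
        (γ * (∑ l ∈ range (r i + 1), ((r i).choose l : ℝ) * (-g) ^ l *
            ((∏ m ∈ range l, (-(θ₀ + ((n + 1 : ℕ) : ℝ)) + m)) / (∏ m ∈ range l, (γ + m)))) /
          (∑ l ∈ range (r i - 1 + 1), ((r i - 1).choose l : ℝ) * (-g) ^ l *
            ((∏ m ∈ range l, (-(θ₀ + ((n + 1 : ℕ) : ℝ)) + m)) / (∏ m ∈ range l, (γ + 1 + m)))))) /
        ((r i - c' j)! : ℕ) else 0).det := by
  set P : ℝ → ℝ → ℕ → ℝ := fun a c r => ∑ l ∈ range (r + 1), (r.choose l : ℝ) * (-g) ^ l *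
    ((∏ m ∈ range l, (a + m)) / (∏ m ∈ range l, (c + m))) with hPdef
  have hP : ∀ a c r, P a c r = ∑ l ∈ range (r + 1), (r.choose l : ℝ) * (-g) ^ l *
    ((∏ m ∈ range l, (a + m)) / (∏ m ∈ range l, (c + m))) := fun _ _ _ => rfl
  have hθ : (0 : ℝ) ≤ θ₀ + ((n + 1 : ℕ) : ℝ) := by positivity
  have hQpos : ∀ m, 0 < P (-(θ₀ + ((n + 1 : ℕ) : ℝ))) γ m :=
    fun m => hyp_pos g P hP hg0 hg1 (-(θ₀ + ((n + 1 : ℕ) : ℝ))) m γ hγ (by linarith)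
  have hPpos : ∀ m, 0 < P (-(θ₀ + ((n + 1 : ℕ) : ℝ))) (γ + 1) m :=
    fun m => hyp_pos g P hP hg0 hg1 (-(θ₀ + ((n + 1 : ℕ) : ℝ))) m (γ + 1) (by linarith) (by linarith)
  have := lPlusC_div_factorial_tn_of_odds
    (fun m => γ * P (-(θ₀ + ((n + 1 : ℕ) : ℝ))) γ m / P (-(θ₀ + ((n + 1 : ℕ) : ℝ))) (γ + 1) (m - 1))
    (fun m => div_pos (mul_pos hγ (hQpos m)) (hPpos (m - 1))) (fun k j => ?_) lam hlam r c' hr hc'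
  · simpa only [hPdef] using this
  · have e : ∀ m : ℕ, ((m : ℕ) : ℝ) / (γ * P (-(θ₀ + ((n + 1 : ℕ) : ℝ))) γ m /
        P (-(θ₀ + ((n + 1 : ℕ) : ℝ))) (γ + 1) (m - 1)) =
        ((m : ℕ) : ℝ) * P (-(θ₀ + ((n + 1 : ℕ) : ℝ))) (γ + 1) (m - 1) / (γ * P (-(θ₀ + ((n + 1 : ℕ) : ℝ))) γ m) := by
      intro m
      have h1' := (hQpos m).ne'
      have h2 := (hPpos (m - 1)).ne'
      have h3 := hγ.ne'
      field_simp
    simp_rw [e]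
    have := pureGrabber_oddsDiff_altSum_nonneg_of_one_lt g P hP hg0 hg1 θ₀ h0 h1 n γ hγ k (j + 1)
    refine le_of_le_of_eq this (sum_congr rfl fun i _ => ?_)
    rw [show j + 1 + i = j + i + 1 by ring]

end HypergeomCM

end Summit.CriticalPhenomena.PercolationContinuityZ3.Theorems
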